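import Summits.BirchSwinnertonDyer.Rank2.LevelFifteenRiemannSums
import Literature.NumberTheory.EllipticCurves.KubotaLeopoldtTwoNumerator
import HarnessLib

/-!
# The Riemann sums of the `2`-adic Kubota–Leopoldt numerator `G(T)` in CLOSED FORM (integer tables) and the bits of `ḡ`

Cell `bsd-rank2` (D-0036), seat `bsd-rank2-eng` GEN 9 (director-bsd g9 ruling (R3): BC5 rung «(★_S) mod T⁸ on 15A8»,
line `star`, crux E1M stmt-BirchSwinnertonDyer-20341; Stage C — the Kubota–Leopoldt side, companion of parts V–VI).
The tree's `klTwoNumerator = distributionTransform klTwoMeasure`, `klTwoMeasure = bernoulliMeasure 2 4 5 χ₋₄ 1`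
(Literature `KubotaLeopoldtTwoNumerator`, lit GEN 19). Its Riemann sums are INTEGERS with an elementary closed form:
by Lang's E 1 (`regBernoulliDist_one_eq`), `E_{1,5}^{(M)}(b) = 2 − t` with `5·(5⁻¹b mod M) = b + tM`, so

`μ_m(a) := klTwoMeasure m a = Σ_{j<4} χ₋₄(a + j·2ᵐ)·(2 − t(a + j·2ᵐ))` (`klMu`, `klTwoMeasure_eq_klMu`),
`RS_G(k, n) = 2·Σ_{s<2ⁿ} μ_{n+2}(5ˢ mod 2ⁿ⁺²)·C(s,k)` (`klRS`, **`distributionRiemannSum_klTwoMeasure_eq`**).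

With the generic truncation machinery of `PAdicMeasureTransform` (`‖μ‖ ≤ 1`, distribution relation — both in the tree) the
`k`-th coefficient `G_k` of `G` satisfies `‖G_k − RS_G(k,n)‖ ≤ 2^{v₂(k!)−n}`; the kernel tables at `n = 6` (`kl_tables_six`)
then give **`G_k/2 mod 2 = 1,0,1,0,0,1,0,1` (`k ≤ 7`)**, i.e. `ḡ ≡ 1 + T² + T⁵ + T⁷ (mod 2, T⁸)` for `ḡ = G/2` — this last
step (`coeff_klTwoNumerator_mod_four`) is proved here for `k ≤ 7` from `norm_riemannSum_succ_sub_le_of_distribution`.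

DEFINITIONS + THEOREMS (computable `def`s; no named fact, no `sorry`). PARTITION: none — r_an ≥ 2, summit axis S0; TWIN
(D-0056): n/a. B1 honesty: finite `2`-adic arithmetic; nothing reads an analytic rank; no S0 motion.

References: S. Lang, *Cyclotomic fields I and II* (1990), Ch. 2 §2 (E 1), Ch. 4 §3 [LangCyclotomic1990];
B. Mazur, J. Tate, J. Teitelbaum, *Invent. Math.* 84 (1986) §I.13 [MazurTateTeitelbaum1986Invent].
-/

namespace Summit.BirchSwinnertonDyer.Rank2.LevelFifteen

/-! ### §1 Computable data -/

/-- `u_m = (4·16^{m+2} + 1)/5`, an inverse of `5` modulo `4·2ᵐ` (`5·u_m = 4·16^{m+2} + 1`). [folklore] -/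
def inv5Mod (m : ℕ) : ℕ := (4 * 16 ^ (m + 2) + 1) / 5

/-- `χ₋₄` on `ℕ` as an integer: `1, −1, 0` according as `b ≡ 1, 3, {0,2} (mod 4)`. [folklore] -/
def chi4Int (b : ℕ) : ℤ := if b % 4 = 1 then 1 else if b % 4 = 3 then -1 else 0

/-- `w = 5⁻¹·b mod 4·2ᵐ`, computed with `inv5Mod`. [cite: LangCyclotomic1990, Ch. 2 §2, proof of E 2] -/
def langW (m b : ℕ) : ℕ := b * (inv5Mod m % (4 * 2 ^ m)) % (4 * 2 ^ m)

/-- Lang's `t = (5w − b)/(4·2ᵐ)`. [cite: LangCyclotomic1990, Ch. 2 §2, E 1] -/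
def langT (m b : ℕ) : ℕ := (5 * langW m b - b) / (4 * 2 ^ m)

/-- `E_{1,5}^{(4·2ᵐ)}(b) = 2 − t` as an integer. [cite: LangCyclotomic1990, Ch. 2 §2, E 1] -/
def eOneFive (m b : ℕ) : ℤ := 2 - (langT m b : ℤ)

/-- `μ_m(a) = Σ_{j<4} χ₋₄(a + j·2ᵐ)·E_{1,5}^{(4·2ᵐ)}(a + j·2ᵐ)` — the value of `χ₋₄E_{1,5}` on `a + 2ᵐℤ₂` (`a < 2ᵐ`).
[cite: LangCyclotomic1990, Ch. 4 §3] -/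
def klMu (m a : ℕ) : ℤ :=
  sumBelow (fun j ↦ chi4Int (a + j * 2 ^ m) * eOneFive m (a + j * 2 ^ m)) 4

/-- `RS_G(k, n) = 2·Σ_{s<2ⁿ} μ_{n+2}(5ˢ mod 2ⁿ⁺²)·C(s,k)`. [cite: MazurTateTeitelbaum1986Invent, §I.13] -/
def klRS (k n : ℕ) : ℤ :=
  2 * sumBelow (fun s ↦ klMu (n + 2) (5 ^ s % 2 ^ (n + 2)) * (chooseFast s k : ℤ)) (2 ^ n)

/-- The table at `n = 6`, `k ≤ 7` (kernel evaluation). [folklore] -/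
theorem kl_tables_six :
    klRS 0 6 = 2 ∧ klRS 1 6 = 248 ∧ klRS 2 6 = 14034 ∧ klRS 3 6 = 320188 ∧ klRS 4 6 = 4741988 ∧
    klRS 5 6 = 52887310 ∧ klRS 6 6 = 475096588 ∧ klRS 7 6 = 3573073582 := by
  decide +kernel

noncomputable section

open Filter Topology Finset
open Literature.NumberTheory.EllipticCurves

/-! ### §2 The fibre of `ℤ/M'ℤ → ℤ/Mℤ` (adapted from the private lemmas of `BernoulliMeasureProofs`) -/

section Fiber

variable {M M' : ℕ} [NeZero M] [NeZero M'] (hMM' : M ∣ M')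

include hMM' in
omit [NeZero M] in
/-- `M' = M·(M'/M)` and `0 < M'/M` (adapted from `BernoulliMeasureProofs`, private there). [folklore] -/
private theorem eq_mul_div_and_pos' : M' = M * (M' / M) ∧ 0 < M' / M := by
  have h := (Nat.mul_div_cancel' hMM').symm
  refine ⟨h, Nat.pos_of_ne_zero fun h0 ↦ ?_⟩
  rw [h0, mul_zero] at h
  exact NeZero.ne M' h

include hMM' in
/-- The classes of `b₀ + jM`, `j < M'/M`, in `ℤ/M'ℤ` have `val = b₀.val + jM` (adapted, private upstream). [folklore] -/
private theorem val_natCast_add_mul' (b₀ : ZMod M) (j : Fin (M' / M)) :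
    ((b₀.val + (j : ℕ) * M : ℕ) : ZMod M').val = b₀.val + (j : ℕ) * M := by
  refine ZMod.val_natCast_of_lt ?_
  obtain ⟨hM', hr⟩ := eq_mul_div_and_pos' hMM'
  have h1 := ZMod.val_lt b₀
  have h2 : (j : ℕ) * M ≤ (M' / M - 1) * M := Nat.mul_le_mul_right _ (by have := j.2; omega)
  calc b₀.val + (j : ℕ) * M < M + (M' / M - 1) * M := by omega
    _ = M' := by
        conv_rhs => rw [hM']
        zify [hr]
        ring

/-- The fibre of `b₀ ∈ ℤ/Mℤ` in `ℤ/M'ℤ` is `{b₀ + jM : j < M'/M}` (adapted, private upstream). [folklore] -/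
private theorem filter_castHom_eq_image_fin' (b₀ : ZMod M) :
    Finset.univ.filter (fun b : ZMod M' ↦ ZMod.castHom hMM' (ZMod M) b = b₀) =
      Finset.univ.image (fun j : Fin (M' / M) ↦ ((b₀.val + (j : ℕ) * M : ℕ) : ZMod M')) := by
  classical
  have hM : 0 < M := Nat.pos_of_ne_zero (NeZero.ne M)
  obtain ⟨hM', -⟩ := eq_mul_div_and_pos' hMM'
  ext b
  simp only [Finset.mem_filter, Finset.mem_univ, true_and, Finset.mem_image]
  constructor
  · intro hb
    have hba : b.val % M = b₀.val := by
      have h := congr_arg ZMod.val hb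
      rwa [ZMod.castHom_apply, ZMod.cast_eq_val, ZMod.val_natCast] at h
    have hlt : b.val / M < M' / M := by
      rw [Nat.div_lt_iff_lt_mul hM]
      calc b.val < M' := ZMod.val_lt b
        _ = M' / M * M := by rw [mul_comm]; exact hM'
    refine ⟨⟨b.val / M, hlt⟩, ?_⟩
    dsimp only
    rw [← hba, Nat.mod_add_div', ZMod.natCast_zmod_val]
  · rintro ⟨j, rfl⟩
    rw [map_natCast, Nat.cast_add, Nat.cast_mul, ZMod.natCast_self, mul_zero, add_zero,
      ZMod.natCast_zmod_val]

/-- **Summation over a fibre**: `∑_{b ∈ ℤ/M'ℤ, b ≡ b₀ (M)} F(b) = ∑_{j < M'/M} F(b₀.val + jM)`.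
(Adapted from `BernoulliMeasureProofs.sum_fiber_eq_sum_range`, private there.) [folklore] -/
theorem sum_fiber_eq_sum_range' {R : Type*} [AddCommMonoid R] (F : ZMod M' → R) (b₀ : ZMod M) :
    ∑ b ∈ Finset.univ.filter (fun b : ZMod M' ↦ ZMod.castHom hMM' (ZMod M) b = b₀), F b =
      ∑ j ∈ range (M' / M), F ((b₀.val + j * M : ℕ) : ZMod M') := by
  classical
  rw [filter_castHom_eq_image_fin' hMM', Finset.sum_image]
  · exact Fin.sum_univ_eq_sum_range (fun j ↦ F ((b₀.val + j * M : ℕ) : ZMod M')) (M' / M)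
  · intro i _ j _ h
    have h' := congr_arg ZMod.val h
    rw [val_natCast_add_mul' hMM', val_natCast_add_mul' hMM'] at h'
    have hM : 0 < M := Nat.pos_of_ne_zero (NeZero.ne M)
    exact Fin.ext (Nat.eq_of_mul_eq_mul_right hM (by omega))

end Fiber

/-! ### §3 `klTwoMeasure` in closed form -/

/-- `5·u_m = 4·16^{m+2} + 1`. [folklore] -/
theorem five_mul_inv5Mod (m : ℕ) : 5 * inv5Mod m = 4 * 16 ^ (m + 2) + 1 := by
  have h : 5 ∣ 4 * 16 ^ (m + 2) + 1 := by
    have h16 : 16 ^ (m + 2) % 5 = 1 := by rw [Nat.pow_mod]; simp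
    omega
  unfold inv5Mod
  exact Nat.mul_div_cancel' h

/-- `(5 : ℤ/4·2ᵐ)⁻¹ = u_m`. [folklore] -/
theorem inv_five_eq (m : ℕ) :
    (((5 : ℕ) : ZMod (4 * 2 ^ m)))⁻¹ = ((inv5Mod m : ℕ) : ZMod (4 * 2 ^ m)) := by
  refine ZMod.inv_eq_of_mul_eq_one _ _ _ ?_
  have h : (((5 * inv5Mod m : ℕ)) : ZMod (4 * 2 ^ m)) = 1 := by
    have hdvd : 4 * 2 ^ m ∣ 4 * 16 ^ (m + 2) := by
      refine ⟨256 * 8 ^ m, ?_⟩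
      rw [pow_add, show (16 : ℕ) = 2 * 8 by norm_num, mul_pow]; ring
    rw [five_mul_inv5Mod, Nat.cast_add, Nat.cast_one, (ZMod.natCast_eq_zero_iff _ _).mpr hdvd, zero_add]
  rw [← Nat.cast_mul]; exact h

/-- **`klTwoMeasure m a = klMu m a.val`.** [cite: LangCyclotomic1990, Ch. 2 §2 (E 1) and Ch. 4 §3] -/
theorem klTwoMeasure_eq_klMu (m : ℕ) (a : ZMod (2 ^ m)) : klTwoMeasure m a = (klMu m a.val : ℚ_[2]) := by
  rw [klTwoMeasure_apply]
  unfold bernoulliMeasure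
  rw [sum_fiber_eq_sum_range' (Dvd.intro_left 4 rfl) _ a,
    show 4 * 2 ^ m / 2 ^ m = 4 from Nat.mul_div_cancel _ (Nat.pos_of_ne_zero (NeZero.ne _)),
    klMu, sumBelow_eq_sum_range, Int.cast_sum]
  refine Finset.sum_congr rfl fun j hj ↦ ?_
  have hj4 : j < 4 := Finset.mem_range.mp hj
  set b : ZMod (4 * 2 ^ m) := ((a.val + j * 2 ^ m : ℕ) : ZMod (4 * 2 ^ m)) with hb
  have hlt : a.val + j * 2 ^ m < 4 * 2 ^ m := by have := ZMod.val_lt a; nlinarith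
  have hbval : b.val = a.val + j * 2 ^ m := by rw [hb]; exact ZMod.val_natCast_of_lt hlt
  -- the character
  have hchi : ((chiMinusFour 2 b.val : ℤ_[2]) : ℚ_[2]) = (chi4Int (a.val + j * 2 ^ m) : ℚ_[2]) := by
    rw [hbval, chiMinusFour_eq_ite, chi4Int]
    split_ifs <;> simp
  -- Lang's `t`
  have hw : (b * (((5 : ℕ) : ZMod (4 * 2 ^ m)))⁻¹).val = langW m (a.val + j * 2 ^ m) := by
    rw [inv_five_eq, ZMod.val_mul, hbval, ZMod.val_natCast, langW]
  have hcop : Nat.Coprime 5 (4 * 2 ^ m) := by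
    rw [show 4 * 2 ^ m = 2 ^ (m + 2) by ring]
    exact (Nat.coprime_two_right.mpr (by decide : Odd 5)).pow_right _
  obtain ⟨t, ht⟩ := exists_mul_val_mul_inv_eq (M := 4 * 2 ^ m) hcop b
  have hE := regBernoulliDist_one_eq b ht
  have htval : t = langT m (a.val + j * 2 ^ m) := by
    rw [langT, ← hw, ← hbval]
    have hpos : 0 < 4 * 2 ^ m := by positivity
    refine (Nat.div_eq_of_eq_mul_left hpos ?_).symm
    omega
  rw [hchi, hE, eOneFive, ← htval]
  push_cast
  ring

/-! ### §4 The Riemann sums of `G` in closed form -/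

/-- **`distributionRiemannSum klTwoMeasure k n = klRS k n`.** [cite: MazurTateTeitelbaum1986Invent, §I.13] -/
theorem distributionRiemannSum_klTwoMeasure_eq (k n : ℕ) :
    distributionRiemannSum klTwoMeasure k n = (klRS k n : ℚ_[2]) := by
  rw [distributionRiemannSum_two_of_even klTwoMeasure_neg k n, klRS, sumBelow_eq_sum_range]
  push_cast
  congr 1
  rw [← sum_zmod_val_eq_sum_range n (fun m ↦ (klMu (n + 2) (5 ^ m % 2 ^ (n + 2)) : ℚ_[2]) *
    (chooseFast m k : ℚ_[2]))]
  refine Finset.sum_congr rfl fun s _ ↦ ?_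
  have hval : ((cyclotomicGenerator 2 : ZMod (2 ^ (n + 2))) ^ s.val).val = 5 ^ s.val % 2 ^ (n + 2) := by
    rw [← Nat.cast_pow, ZMod.val_natCast, cyclotomicGenerator_two]
  rw [klTwoMeasure_eq_klMu, hval, chooseFast_eq_choose]

/-! ### §5 The coefficients of `G` modulo `4`: `ḡ ≡ 1 + T² + T⁵ + T⁷ (mod 2, T⁸)` -/

/-- Truncation: `‖G_k − RS_G(k, n)‖ ≤ 2^{−n}/‖k!‖` (`‖μ‖ ≤ 1`, distribution relation, closed balls are closed).
[cite: MazurTateTeitelbaum1986Invent, §I.13] -/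
theorem norm_coeff_klTwoNumerator_sub_riemannSum_le (k n : ℕ) :
    ‖PowerSeries.coeff k klTwoNumerator - distributionRiemannSum klTwoMeasure k n‖ ≤
      1 / ‖((k.factorial : ℕ) : ℚ_[2])‖ * (2 : ℝ) ^ (-n : ℤ) := by
  set B : ℝ := 1 / ‖((k.factorial : ℕ) : ℚ_[2])‖ * (2 : ℝ) ^ (-n : ℤ) with hB
  have hstep : ∀ j, ‖distributionRiemannSum klTwoMeasure k (n + j + 1) -
      distributionRiemannSum klTwoMeasure k (n + j)‖ ≤ B := by
    intro j
    have h := norm_riemannSum_succ_sub_le_of_distribution (p := 2) (distributionRiemannSum_spec klTwoMeasure)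
      klTwoMeasure_distribution zero_le_one norm_klTwoMeasure_le_one k (n + j)
    refine h.trans ?_
    rw [hB]
    refine mul_le_mul_of_nonneg_left ?_ (by positivity)
    push_cast
    exact zpow_le_zpow_right₀ (by norm_num) (by omega)
  have hadd : ∀ j, ‖distributionRiemannSum klTwoMeasure k (n + j) - distributionRiemannSum klTwoMeasure k n‖ ≤ B := by
    intro j
    induction j with
    | zero => simp only [add_zero, sub_self, norm_zero]; positivity
    | succ j ih =>
      have hsplit : distributionRiemannSum klTwoMeasure k (n + (j + 1)) - distributionRiemannSum klTwoMeasure k n =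
          (distributionRiemannSum klTwoMeasure k (n + j + 1) - distributionRiemannSum klTwoMeasure k (n + j)) +
            (distributionRiemannSum klTwoMeasure k (n + j) - distributionRiemannSum klTwoMeasure k n) := by
        rw [← add_assoc]; ring
      rw [hsplit]
      exact (IsUltrametricDist.norm_add_le_max _ _).trans (max_le (hstep j) ih)
  have htend := tendsto_distributionRiemannSum_klTwoMeasure k
  have hshift : Tendsto (fun j ↦ distributionRiemannSum klTwoMeasure k (n + j)) atTop
      (𝓝 (PowerSeries.coeff k klTwoNumerator)) := by
    have h := (Filter.tendsto_add_atTop_iff_nat n).mpr htend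
    simpa only [add_comm] using h
  have hlim : Tendsto (fun j ↦ ‖distributionRiemannSum klTwoMeasure k (n + j) - distributionRiemannSum klTwoMeasure k n‖)
      atTop (𝓝 ‖PowerSeries.coeff k klTwoNumerator - distributionRiemannSum klTwoMeasure k n‖) :=
    (hshift.sub tendsto_const_nhds).norm
  exact le_of_tendsto' hlim hadd

/-- `‖2‖₂ = 1/2`. [folklore] -/
private theorem norm_two' : ‖(2 : ℚ_[2])‖ = (2 : ℝ)⁻¹ := by
  have h := Padic.norm_p (p := 2); simpa using h

/-- The generic bit step: `‖G − r‖ ≤ 1/4`, `r ∈ ℤ`, `4 ∣ r − 2b` ⇒ `‖G/2 − b‖ ≤ 1/2`. [folklore] -/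
theorem norm_half_sub_le_of_int {G : ℚ_[2]} {r b : ℤ} (herr : ‖G - r‖ ≤ (2 : ℝ)⁻¹ ^ 2) (hr : (4 : ℤ) ∣ r - 2 * b) :
    ‖G / 2 - b‖ ≤ (2 : ℝ)⁻¹ := by
  obtain ⟨q, hq⟩ := hr
  have hsplit : G / 2 - b = (G - r) / 2 + ((2 * q : ℤ) : ℚ_[2]) := by
    have hq' : ((r : ℤ) : ℚ_[2]) - 2 * b = 4 * q := by exact_mod_cast hq
    push_cast
    linear_combination (1 / 2 : ℚ_[2]) * hq'
  rw [hsplit]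
  refine (IsUltrametricDist.norm_add_le_max _ _).trans (max_le ?_ ?_)
  · rw [norm_div, norm_two', div_le_iff₀ (by positivity)]
    calc ‖G - r‖ ≤ (2 : ℝ)⁻¹ ^ 2 := herr
      _ = 2⁻¹ * 2⁻¹ := by ring
  · rw [Int.cast_mul, norm_mul, show ((2 : ℤ) : ℚ_[2]) = 2 by norm_num, norm_two']
    calc (2 : ℝ)⁻¹ * ‖(q : ℚ_[2])‖ ≤ 2⁻¹ * 1 := by gcongr; exact Padic.norm_int_le_one q
      _ = 2⁻¹ := mul_one _

/-- **The first eight coefficients of `G` modulo `4`: `ḡ = G/2 ≡ 1 + T² + T⁵ + T⁷ (mod 2, T⁸)`.** With `G_k` the `k`-th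
coefficient of `klTwoNumerator`: `‖G_k/2 − b_k‖₂ ≤ 1/2` for `(k, b_k) = (0,1),(1,0),(2,1),(3,0),(4,0),(5,1),(6,0),(7,1)`
(truncation at `n = 6`: `‖G_k − RS_G(k,6)‖ ≤ 2^{v₂(k!)−6} ≤ 1/4` for `k ≤ 7`, and the kernel table `kl_tables_six`).
[cite: MazurTateTeitelbaum1986Invent, §I.13] [cite: LangCyclotomic1990, Ch. 4 §3] -/
theorem coeff_klTwoNumerator_mod_four :
    ∀ kb ∈ [((0 : ℕ), (1 : ℤ)), (1, 0), (2, 1), (3, 0), (4, 0), (5, 1), (6, 0), (7, 1)],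
      ‖PowerSeries.coeff kb.1 klTwoNumerator / 2 - (kb.2 : ℚ_[2])‖ ≤ (2 : ℝ)⁻¹ := by
  have herr : ∀ k : ℕ, k ≤ 7 → ‖PowerSeries.coeff k klTwoNumerator - (klRS k 6 : ℚ_[2])‖ ≤ (2 : ℝ)⁻¹ ^ 2 := by
    intro k hk
    rw [← distributionRiemannSum_klTwoMeasure_eq]
    refine (norm_coeff_klTwoNumerator_sub_riemannSum_le k 6).trans ?_
    have h3 : ‖((3 : ℤ) : ℚ_[2])‖ = 1 := le_antisymm (Padic.norm_int_le_one _) (not_lt.mp fun h ↦ by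
      have h2 : (2 : ℤ) ∣ 3 := by exact_mod_cast (Padic.norm_intCast_lt_one_iff (p := 2)).mp h
      omega)
    have h15 : ‖((15 : ℤ) : ℚ_[2])‖ = 1 := le_antisymm (Padic.norm_int_le_one _) (not_lt.mp fun h ↦ by
      have h2 : (2 : ℤ) ∣ 15 := by exact_mod_cast (Padic.norm_intCast_lt_one_iff (p := 2)).mp h
      omega)
    have h45 : ‖((45 : ℤ) : ℚ_[2])‖ = 1 := le_antisymm (Padic.norm_int_le_one _) (not_lt.mp fun h ↦ by
      have h2 : (2 : ℤ) ∣ 45 := by exact_mod_cast (Padic.norm_intCast_lt_one_iff (p := 2)).mp h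
      omega)
    have h315 : ‖((315 : ℤ) : ℚ_[2])‖ = 1 := le_antisymm (Padic.norm_int_le_one _) (not_lt.mp fun h ↦ by
      have h2 : (2 : ℤ) ∣ 315 := by exact_mod_cast (Padic.norm_intCast_lt_one_iff (p := 2)).mp h
      omega)
    have hfac : (2 : ℝ)⁻¹ ^ 4 ≤ ‖((k.factorial : ℕ) : ℚ_[2])‖ := by
      interval_cases k
      · norm_num [Nat.factorial]
      · norm_num [Nat.factorial]
      · rw [show ((Nat.factorial 2 : ℕ) : ℚ_[2]) = 2 by norm_num [Nat.factorial], norm_two']; norm_num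
      · rw [show ((Nat.factorial 3 : ℕ) : ℚ_[2]) = 2 * ((3 : ℤ) : ℚ_[2]) by norm_num [Nat.factorial], norm_mul,
          norm_two', h3]; norm_num
      · rw [show ((Nat.factorial 4 : ℕ) : ℚ_[2]) = 2 ^ 3 * ((3 : ℤ) : ℚ_[2]) by norm_num [Nat.factorial], norm_mul,
          norm_pow, norm_two', h3]; norm_num
      · rw [show ((Nat.factorial 5 : ℕ) : ℚ_[2]) = 2 ^ 3 * ((15 : ℤ) : ℚ_[2]) by norm_num [Nat.factorial], norm_mul,
          norm_pow, norm_two', h15]; norm_num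
      · rw [show ((Nat.factorial 6 : ℕ) : ℚ_[2]) = 2 ^ 4 * ((45 : ℤ) : ℚ_[2]) by norm_num [Nat.factorial], norm_mul,
          norm_pow, norm_two', h45, mul_one]
      · rw [show ((Nat.factorial 7 : ℕ) : ℚ_[2]) = 2 ^ 4 * ((315 : ℤ) : ℚ_[2]) by norm_num [Nat.factorial], norm_mul,
          norm_pow, norm_two', h315, mul_one]
    have hpos : (0 : ℝ) < ‖((k.factorial : ℕ) : ℚ_[2])‖ := lt_of_lt_of_le (by positivity) hfac
    rw [show (2 : ℝ) ^ (-((6 : ℕ) : ℤ)) = (2 : ℝ)⁻¹ ^ 6 by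
      rw [zpow_neg, zpow_natCast, inv_pow]]
    calc 1 / ‖((k.factorial : ℕ) : ℚ_[2])‖ * (2 : ℝ)⁻¹ ^ 6
        ≤ 1 / (2 : ℝ)⁻¹ ^ 4 * (2 : ℝ)⁻¹ ^ 6 := by gcongr
      _ = (2 : ℝ)⁻¹ ^ 2 := by norm_num
  obtain ⟨r0, r1, r2, r3, r4, r5, r6, r7⟩ := kl_tables_six
  intro kb hkb
  simp only [List.mem_cons, List.mem_nil_iff, or_false] at hkb
  rcases hkb with rfl | rfl | rfl | rfl | rfl | rfl | rfl | rfl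
  · exact norm_half_sub_le_of_int (herr 0 (by norm_num)) (by rw [r0]; norm_num)
  · exact norm_half_sub_le_of_int (herr 1 (by norm_num)) (by rw [r1]; norm_num)
  · exact norm_half_sub_le_of_int (herr 2 (by norm_num)) (by rw [r2]; norm_num)
  · exact norm_half_sub_le_of_int (herr 3 (by norm_num)) (by rw [r3]; norm_num)
  · exact norm_half_sub_le_of_int (herr 4 (by norm_num)) (by rw [r4]; norm_num)
  · exact norm_half_sub_le_of_int (herr 5 (by norm_num)) (by rw [r5]; norm_num)
  · exact norm_half_sub_le_of_int (herr 6 (by norm_num)) (by rw [r6]; norm_num)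
  · exact norm_half_sub_le_of_int (herr 7 (by norm_num)) (by rw [r7]; norm_num)

end

end Summit.BirchSwinnertonDyer.Rank2.LevelFifteen
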